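import Literature.Computability.Complexity.CodeFPStrings
import Literature.Computability.Complexity.SipserCodingLemma
import HarnessLib

/-!
# GF(2) hashing of bit strings: polynomial-time hash families on words (tool for THEOREM E♯)

Support file for the kernel form of THEOREM E♯ of the solo report (under `NP ⊆ P`, every language
of `P` has one polynomial-time one-pass streaming algorithm whose state length stays within
`O(log N)` of the logarithm of its Myhill–Nerode class count).  The short names of the Nerode
classes are HASH VALUES: Sipser's Coding Lemma (`SipserCodingLemma.lean`, over `Fin M → Bool`)
supplies, for a set `X` with `2·|X| ≤ 2ᵏ`, a family of `k` Boolean `k × M` matrices such that every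
member of `X` is isolated by one of them, so that `(j, Hⱼ y)` is an injective name of `k + O(log k)`
bits.  This file moves that statement to BIT STRINGS (the objects a streaming algorithm and a
`CodeFP` computation handle) and records that hashing is polynomial time:

* `StrHash.sdot r y` — the `GF(2)` inner product of two bit strings as a bit (the parity of the
  number of common `1`s), `StrHash.shash H y` — the vector of row products, as a bit string;
* `StrHash.codeFP_sdot`, `StrHash.codeFP_shash`, `StrHash.codeFP_wf` — all polynomial time
  (`HashBricks.andParityFn`);
* `StrHash.sdot_ofFn` — the dictionary with `SipserHash.dotZ`;
* `StrHash.exists_sepFamily` — **Sipser's Coding Lemma for strings**: if every member of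
  `X ⊆ {0,1}ⁱ` and `2·|X| ≤ 2ᵏ`, some well-formed family of `k` matrices with `k` rows of length
  `i` separates `X` under `shash`.

All statements proved; no hypotheses beyond those displayed.

References: M. Sipser, *A complexity theoretic approach to randomness*, STOC 1983 (Coding Lemma);
Y. Han, L. A. Hemaspaandra, T. Thierauf, *Threshold computation and cryptographic security*,
SIAM J. Comput. 26 (1997), Def. 3.8–Lemma 3.9; S. Arora, B. Barak, *Computational Complexity:
A Modern Approach*, CUP 2009, §1.3 (polynomial-time string functions).
-/

namespace Summit.PneNP.PneNP.Theorems.SoloBlind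

open Literature.Computability.Complexity
open Literature.Computability.Complexity.CodeFP (natE unE bitE pairE rawE strE pairE_apply)

namespace StrHash

/-! ### Hash values of strings -/

/-- `GF(2)` inner product of two bit strings, as a bit: the parity of `#{c | r_c = y_c = 1}`
(extra positions of the longer string are ignored). [cite: HanHemaspaandraThierauf1997, Def. 3.8] -/
def sdot (r y : List Bool) : Bool := decide (Odd ((r.zipWith (· && ·) y).count true))

/-- Hash value of the string `y` under the matrix `H` (a list of rows): the string of row
products. [cite: HanHemaspaandraThierauf1997, Def. 3.8] -/
def shash (H : List (List Bool)) (y : List Bool) : List Bool := H.map fun r => sdot r y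

/-- Well-formed families: `k` matrices, each with `k` rows of length `i`. [folklore] -/
def wf (k i : ℕ) (F : List (List (List Bool))) : Bool :=
  decide (F.length = k) && F.all fun H => decide (H.length = k) && H.all fun r => decide (r.length = i)

/-- A hash value has one bit per row. [folklore] -/
@[simp] theorem length_shash (H : List (List Bool)) (y : List Bool) : (shash H y).length = H.length :=
  List.length_map _

/-- Reading of well-formedness. [folklore] -/
theorem wf_eq_true_iff {k i : ℕ} {F : List (List (List Bool))} :
    wf k i F = true ↔ F.length = k ∧ ∀ H ∈ F, H.length = k ∧ ∀ r ∈ H, r.length = i := by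
  simp [wf, List.all_eq_true, Bool.and_eq_true, decide_eq_true_eq]

/-! ### Polynomial time -/

/-- The inner product is polynomial time (`HashBricks.andParityFn`). [folklore] -/
theorem codeFP_sdot : CodeFP (pairE strE strE) bitE (fun p => sdot p.1 p.2) :=
  CodeFP.of_fn HashBricks.andParityFn HashBricks.andParityFn_mem_FP fun p => by
    rw [pairE_apply]
    exact HashBricks.andParityFn_boolPair p.1 p.2

/-- Hashing is polynomial time. [cite: AroraBarak2009, §1.3] -/
theorem codeFP_shash : CodeFP (pairE (rawE strE) strE) strE (fun p => shash p.1 p.2) :=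
  (CodeFP.bitsToStr.comp ((CodeFP.map (codeFP_sdot.comp ((CodeFP.snd strE strE).pair
    (CodeFP.fst strE strE)))).comp ((CodeFP.snd _ _).pair (CodeFP.fst _ _)))).congr fun _ => rfl

/-- Well-formedness is polynomial time. [cite: AroraBarak2009, §1.3] -/
theorem codeFP_wf : CodeFP (pairE natE (pairE natE (rawE (rawE strE)))) bitE
    (fun t => wf t.1 t.2.1 t.2.2) := by
  have hk : CodeFP (pairE natE (pairE natE (rawE (rawE strE)))) natE (fun t => t.1) := CodeFP.fst _ _
  have hi : CodeFP (pairE natE (pairE natE (rawE (rawE strE)))) natE (fun t => t.2.1) :=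
    (CodeFP.snd _ _).fst'
  have hF : CodeFP (pairE natE (pairE natE (rawE (rawE strE)))) (rawE (rawE strE))
      (fun t => t.2.2) := (CodeFP.snd _ _).snd'
  -- row test with context `i`: `|r| = i`
  have hrow : CodeFP (pairE natE strE) bitE (fun q => decide (q.2.length = q.1)) :=
    CodeFP.natEq.comp ((CodeFP.strNatLength.comp (CodeFP.snd _ _)).pair (CodeFP.fst _ _))
  -- matrix test with context `(k, i)`: `|H| = k ∧ all rows`
  have hmat : CodeFP (pairE (pairE natE natE) (rawE strE)) bitE
      (fun q => decide (q.2.length = q.1.1) && q.2.all fun r => decide (r.length = q.1.2)) :=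
    (CodeFP.natEq.comp (((CodeFP.natLength strE).comp (CodeFP.snd _ _)).pair
      (CodeFP.fst _ _).fst')).and
      ((CodeFP.all hrow).comp ((CodeFP.fst _ _).snd'.pair (CodeFP.snd _ _)))
  exact ((CodeFP.natEq.comp (((CodeFP.natLength (rawE strE)).comp hF).pair hk)).and
    ((CodeFP.all hmat).comp ((hk.pair hi).pair hF))).congr fun _ => rfl

/-! ### Dictionary with `SipserHash` -/

/-- Casting the number of `true`s to `GF(2)`. [folklore] -/
theorem cast_count_true (l : List Bool) :
    ((l.count true : ℕ) : ZMod 2) = (l.map fun b => if b then (1 : ZMod 2) else 0).sum := by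
  induction l with
  | nil => simp
  | cons b l ih => cases b <;> simp [ih, add_comm]

/-- `SipserHash.dotZ` is the parity of the number of common `1`s. [folklore] -/
theorem dotZ_eq_cast_count {i : ℕ} (r v : Fin i → Bool) :
    SipserHash.dotZ r v = (((List.ofFn fun c => r c && v c).count true : ℕ) : ZMod 2) := by
  rw [cast_count_true, List.map_ofFn, List.sum_ofFn]
  rfl

/-- Pointwise product of a row given as a function with a string of the right length. [folklore] -/
theorem zipWith_ofFn {i : ℕ} (r : Fin i → Bool) {y : List Bool} (hy : y.length = i) :
    (List.ofFn r).zipWith (· && ·) y = List.ofFn fun c => r c && y.getD c false := by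
  apply List.ext_getElem
  · simp [hy]
  · intro n h1 h2
    rw [List.length_ofFn] at h2
    have hn : n < y.length := hy ▸ h2
    simp only [List.getElem_zipWith, List.getElem_ofFn, List.getD_eq_getElem?_getD,
      List.getElem?_eq_getElem hn, Option.getD_some]

/-- **Dictionary**: on a string of length `i`, the string product with the row `List.ofFn r` is
the `GF(2)` product `SipserHash.dotZ r` of the corresponding vectors. [folklore] -/
theorem sdot_ofFn {i : ℕ} (r : Fin i → Bool) {y : List Bool} (hy : y.length = i) :
    sdot (List.ofFn r) y = decide (SipserHash.dotZ r (fun c => y.getD c false) = 1) := by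
  rw [sdot, zipWith_ofFn r hy, dotZ_eq_cast_count, decide_eq_decide, ZMod.natCast_eq_one_iff_odd]

/-- Strings of a fixed length are determined by their coordinate vectors. [folklore] -/
theorem injOn_getD {i : ℕ} {X : Finset (List Bool)} (hX : ∀ y ∈ X, y.length = i) :
    Set.InjOn (fun (y : List Bool) (c : Fin i) => y.getD c false) X := by
  intro y hy z hz h
  apply List.ext_getElem (by rw [hX y hy, hX z hz])
  intro n h1 h2
  have := congrFun h ⟨n, hX y hy ▸ h1⟩
  simpa [List.getD_eq_getElem?_getD, List.getElem?_eq_getElem h1,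
    List.getElem?_eq_getElem h2] using this

/-- **Sipser's Coding Lemma for strings.** If `X ⊆ {0,1}ⁱ` and `2·|X| ≤ 2ᵏ`, a well-formed family
of `k` matrices (each `k` rows of length `i`) separates `X`: every `y ∈ X` is isolated by some
matrix `F[j]`, i.e. no other member of `X` has the same hash value under `F[j]`.
[cite: Sipser1983, Coding Lemma] [cite: HanHemaspaandraThierauf1997, Lemma 3.9] -/
theorem exists_sepFamily {i k : ℕ} {X : Finset (List Bool)} (hX : ∀ y ∈ X, y.length = i)
    (hcard : 2 * X.card ≤ 2 ^ k) :
    ∃ F : List (List (List Bool)), wf k i F = true ∧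
      ∀ y ∈ X, ∃ j < k, ∀ z ∈ X, z ≠ y → shash (F.getD j []) z ≠ shash (F.getD j []) y := by
  classical
  set toV : List Bool → (Fin i → Bool) := fun y c => y.getD c false with htoV
  have hinj : Set.InjOn toV X := injOn_getD hX
  have hcard' : 2 * (X.image toV).card ≤ 2 ^ k := by rwa [Finset.card_image_of_injOn hinj]
  obtain ⟨H, hH⟩ := SipserHash.hashable_of_card_le hcard'
  refine ⟨List.ofFn fun j => List.ofFn fun ρ => List.ofFn (H j ρ), ?_, ?_⟩
  · rw [wf_eq_true_iff]
    refine ⟨List.length_ofFn, fun Hm hHm => ?_⟩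
    obtain ⟨j, rfl⟩ := List.mem_ofFn.1 hHm
    refine ⟨List.length_ofFn, fun r hr => ?_⟩
    obtain ⟨ρ, rfl⟩ := List.mem_ofFn.1 hr
    exact List.length_ofFn
  · intro y hy
    obtain ⟨j, hj⟩ := hH (toV y) (Finset.mem_image_of_mem _ hy)
    refine ⟨j, j.isLt, fun z hz hne habs => ?_⟩
    have hget : (List.ofFn fun j => List.ofFn fun ρ => List.ofFn (H j ρ)).getD j [] =
        List.ofFn fun ρ => List.ofFn (H j ρ) := by
      simp [List.getD_eq_getElem?_getD]
    rw [hget, shash, shash, List.map_ofFn, List.map_ofFn, List.ofFn_inj] at habs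
    refine hj (toV z) (Finset.mem_image_of_mem _ hz) (fun h => hne (hinj hz hy h)) (funext fun ρ => ?_)
    have hρ := congrFun habs ρ
    simp only [Function.comp_apply, sdot_ofFn _ (hX z hz), sdot_ofFn _ (hX y hy)] at hρ
    have key : ∀ a b : ZMod 2, decide (a = 1) = decide (b = 1) → a = b := by decide
    exact key _ _ hρ

end StrHash

end Summit.PneNP.PneNP.Theorems.SoloBlind
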